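import Mathlib.Analysis.InnerProductSpace.Spectrum
import Mathlib.Analysis.InnerProductSpace.PiL2
import Mathlib.LinearAlgebra.Eigenspace.Triangularizable
import Mathlib.Analysis.Complex.Polynomial.Basic
import Mathlib.Analysis.SpecialFunctions.Complex.Arg
import Mathlib.LinearAlgebra.Matrix.NonsingularInverse
import HarnessLib

/-!
# Unitary matrices are unitarily diagonalisable (spectral theorem for unitary operators)

Topic `Literature/LinearAlgebra/Matrix`. The pinned Mathlib has the spectral theorem for
self-adjoint operators / Hermitian matrices (`LinearMap.IsSymmetric.eigenvectorBasis`,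
`Matrix.IsHermitian.spectral_theorem`) but not for normal or unitary ones. This file proves the
unitary case, following Mathlib's proof for symmetric operators step by step (orthogonality of
eigenspaces, invariance of the orthogonal complement of their span, existence of an eigenvalue on a
nontrivial invariant subspace over `ℂ`, `DirectSum.IsInternal.subordinateOrthonormalBasis`), and
packages it for matrices:

* `LinearMap.IsIsometric` — `⟪T v, T w⟫ = ⟪v, w⟫` for all `v, w` (on a finite-dimensional space this is
  unitarity);
* `LinearMap.IsIsometric.direct_sum_isInternal` — the eigenspaces of an isometric endomorphism of a
  finite-dimensional complex inner product space form an internal orthogonal direct sum;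
* `Matrix.exists_unitary_diagonalization` — for `U ∈ M_N(ℂ)` with `Uᴴ U = 1` there are `g` with
  `gᴴ g = 1` and `θ : Fin N → ℝ` with `U = g · diagonal (fun a => exp (θ a · I)) · gᴴ`.

Standard textbook material: Horn–Johnson, *Matrix Analysis* (2nd ed.), Thm. 2.5.3 (normal, in
particular unitary, matrices are unitarily diagonalisable) [HornJohnson2013]. All declarations but
the final theorem are private helpers.
-/

noncomputable section

open scoped ComplexConjugate InnerProductSpace
open Module Module.End Complex Matrix

namespace Literature.LinearAlgebra.Matrix

/-! ### Isometric endomorphisms of an inner product space -/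

section LinearMapPart

variable {E : Type*} [NormedAddCommGroup E] [InnerProductSpace ℂ E]

/-- `T` is isometric: `⟪T v, T w⟫ = ⟪v, w⟫` for all `v, w`. [folklore] -/
private def LinearMap.IsIsometric (T : E →ₗ[ℂ] E) : Prop := ∀ v w : E, ⟪T v, T w⟫_ℂ = ⟪v, w⟫_ℂ

namespace LinearMap.IsIsometric

variable {T : E →ₗ[ℂ] E}

/-- Eigenvalues of an isometric map are unimodular: `conj μ * μ = 1`. [folklore] -/
private theorem conj_mul_eigenvalue (hT : LinearMap.IsIsometric T) {μ : ℂ} {v : E}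
    (hv : HasEigenvector T μ v) : conj μ * μ = 1 := by
  have h1 : T v = μ • v := mem_eigenspace_iff.1 hv.1
  have h2 := hT v v
  rw [h1, inner_smul_left, inner_smul_right, ← mul_assoc] at h2
  have hvv : ⟪v, v⟫_ℂ ≠ 0 := inner_self_ne_zero.2 hv.2
  have := mul_right_cancel₀ hvv (h2.trans (one_mul _).symm)
  exact this

/-- An isometric map preserves the orthogonal complement of each eigenspace. [folklore] -/
private theorem invariant_orthogonalComplement_eigenspace (hT : LinearMap.IsIsometric T) (μ : ℂ) (v : E)
    (hv : v ∈ (eigenspace T μ)ᗮ) : T v ∈ (eigenspace T μ)ᗮ := by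
  intro w hw
  have hTw : T w = μ • w := mem_eigenspace_iff.1 hw
  by_cases hw0 : w = 0
  · simp [hw0]
  have hμ : conj μ * μ = 1 := hT.conj_mul_eigenvalue ⟨hw, hw0⟩
  have hμ0 : conj μ ≠ 0 := fun h => by simp [h] at hμ
  have h := hT w v
  rw [hTw, inner_smul_left, hv w hw] at h
  -- `conj μ * ⟪w, T v⟫ = 0`
  exact (mul_eq_zero.1 h).resolve_left hμ0

/-- The eigenspaces of an isometric map are mutually orthogonal. [folklore] -/
private theorem orthogonalFamily_eigenspaces (hT : LinearMap.IsIsometric T) :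
    OrthogonalFamily ℂ (fun μ => eigenspace T μ) fun μ => (eigenspace T μ).subtypeₗᵢ := by
  rintro μ ν hμν ⟨v, hv⟩ ⟨w, hw⟩
  by_cases hv0 : v = 0
  · simp [hv0]
  have hμ : conj μ * μ = 1 := hT.conj_mul_eigenvalue ⟨hv, hv0⟩
  have hTv : T v = μ • v := mem_eigenspace_iff.1 hv
  have hTw : T w = ν • w := mem_eigenspace_iff.1 hw
  have h := hT v w
  rw [hTv, hTw, inner_smul_left, inner_smul_right, ← mul_assoc] at h
  -- `conj μ * ν * ⟪v,w⟫ = ⟪v,w⟫`; `conj μ * ν ≠ 1` since `ν ≠ μ`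
  have hne : conj μ * ν ≠ 1 := by
    intro h1
    apply hμν
    have hμ0 : conj μ ≠ 0 := fun h0 => by simp [h0] at hμ
    exact mul_left_cancel₀ hμ0 (hμ.trans h1.symm)
  have : (conj μ * ν - 1) * ⟪v, w⟫_ℂ = 0 := by rw [sub_mul, one_mul, sub_eq_zero]; exact h
  simpa using (mul_eq_zero.1 this).resolve_left (sub_ne_zero.2 hne)

/-- Orthogonality restricted to actual eigenvalues. [folklore] -/
private theorem orthogonalFamily_eigenspaces' (hT : LinearMap.IsIsometric T) :
    OrthogonalFamily ℂ (fun μ : Eigenvalues T => eigenspace T μ) fun μ =>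
      (eigenspace T μ).subtypeₗᵢ :=
  hT.orthogonalFamily_eigenspaces.comp Subtype.coe_injective

/-- The orthogonal complement of the span of the eigenspaces is invariant. [folklore] -/
private theorem orthogonalComplement_iSup_eigenspaces_invariant (hT : LinearMap.IsIsometric T) ⦃v : E⦄
    (hv : v ∈ (⨆ μ, eigenspace T μ)ᗮ) : T v ∈ (⨆ μ, eigenspace T μ)ᗮ := by
  rw [← Submodule.iInf_orthogonal] at hv ⊢
  exact T.iInf_invariant hT.invariant_orthogonalComplement_eigenspace v hv

/-- On that complement the restricted map has no eigenvectors. [folklore] -/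
private theorem orthogonalComplement_iSup_eigenspaces (hT : LinearMap.IsIsometric T) (μ : ℂ) :
    eigenspace (T.restrict hT.orthogonalComplement_iSup_eigenspaces_invariant) μ = ⊥ := by
  set p : Submodule ℂ E := (⨆ μ, eigenspace T μ)ᗮ
  refine eigenspace_restrict_eq_bot hT.orthogonalComplement_iSup_eigenspaces_invariant ?_
  have H₂ : eigenspace T μ ⟂ p := (Submodule.isOrtho_orthogonal_right _).mono_left (le_iSup _ _)
  exact H₂.disjoint

variable [FiniteDimensional ℂ E]

/-- Over `ℂ` and in finite dimension the complement is trivial (every nontrivial invariant subspace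
carries an eigenvector). [folklore] -/
private theorem orthogonalComplement_iSup_eigenspaces_eq_bot (hT : LinearMap.IsIsometric T) :
    (⨆ μ, eigenspace T μ)ᗮ = ⊥ := by
  set p : Submodule ℂ E := (⨆ μ, eigenspace T μ)ᗮ with hp
  by_contra hne
  have : Nontrivial p := Submodule.nontrivial_iff_ne_bot.2 hne
  obtain ⟨c, hc⟩ := exists_eigenvalue (T.restrict hT.orthogonalComplement_iSup_eigenspaces_invariant)
  exact hc (hT.orthogonalComplement_iSup_eigenspaces c)

/-- Same with the eigenvalue subtype. [folklore] -/
private theorem orthogonalComplement_iSup_eigenspaces_eq_bot' (hT : LinearMap.IsIsometric T) :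
    (⨆ μ : Eigenvalues T, eigenspace T μ)ᗮ = ⊥ :=
  show (⨆ μ : { μ // eigenspace T μ ≠ ⊥ }, eigenspace T μ)ᗮ = ⊥ by
    rw [iSup_ne_bot_subtype, hT.orthogonalComplement_iSup_eigenspaces_eq_bot]

/-- **Internal orthogonal direct sum of eigenspaces** of an isometric endomorphism of a
finite-dimensional complex inner product space. [folklore] -/
private theorem direct_sum_isInternal (hT : LinearMap.IsIsometric T) :
    DirectSum.IsInternal fun μ : Eigenvalues T => eigenspace T μ :=
  hT.orthogonalFamily_eigenspaces'.isInternal_iff.mpr hT.orthogonalComplement_iSup_eigenspaces_eq_bot'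

variable {n : ℕ}

/-- An orthonormal basis of eigenvectors. [folklore] -/
private def eigenvectorBasis (hT : LinearMap.IsIsometric T) (hn : Module.finrank ℂ E = n) :
    OrthonormalBasis (Fin n) ℂ E :=
  hT.direct_sum_isInternal.subordinateOrthonormalBasis hn hT.orthogonalFamily_eigenspaces'

/-- The corresponding eigenvalues. [folklore] -/
private def eigenvalues (hT : LinearMap.IsIsometric T) (hn : Module.finrank ℂ E = n) (i : Fin n) : ℂ :=
  (hT.direct_sum_isInternal.subordinateOrthonormalBasisIndex hn i hT.orthogonalFamily_eigenspaces').val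

/-- Each basis vector is an eigenvector for the recorded eigenvalue. [folklore] -/
private theorem hasEigenvector_eigenvectorBasis (hT : LinearMap.IsIsometric T) (hn : Module.finrank ℂ E = n)
    (i : Fin n) : HasEigenvector T (hT.eigenvalues hn i) (hT.eigenvectorBasis hn i) := by
  refine ⟨?_, ?_⟩
  · simp only [eigenvectorBasis, eigenvalues]
    exact hT.direct_sum_isInternal.subordinateOrthonormalBasis_subordinate hn i
      hT.orthogonalFamily_eigenspaces'
  · simpa using (hT.eigenvectorBasis hn).toBasis.ne_zero i

end LinearMap.IsIsometric

end LinearMapPart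

/-! ### Matrices -/

section MatrixPart

variable {N : ℕ}

/-- A matrix with `Uᴴ U = 1` acts isometrically on `EuclideanSpace ℂ (Fin N)`. [folklore] -/
private theorem isIsometric_toEuclideanLin (U : Matrix (Fin N) (Fin N) ℂ) (hU : Uᴴ * U = 1) :
    LinearMap.IsIsometric (Matrix.toEuclideanLin U) := by
  intro v w
  rw [EuclideanSpace.inner_eq_star_dotProduct, EuclideanSpace.inner_eq_star_dotProduct]
  change (U *ᵥ WithLp.ofLp w) ⬝ᵥ star (U *ᵥ WithLp.ofLp v) = WithLp.ofLp w ⬝ᵥ star (WithLp.ofLp v)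
  rw [Matrix.star_mulVec, dotProduct_comm, Matrix.dotProduct_mulVec, Matrix.vecMul_vecMul, hU,
    Matrix.vecMul_one, dotProduct_comm]

/-- An eigenvalue of an isometry is unimodular. [folklore] -/
private theorem norm_eq_one_of_conj_mul_self {μ : ℂ} (h : conj μ * μ = 1) : ‖μ‖ = 1 := by
  have h1 : Complex.normSq μ = 1 := by
    have := Complex.normSq_eq_conj_mul_self (z := μ)
    rw [h] at this
    exact_mod_cast this
  rw [Complex.normSq_eq_norm_sq] at h1
  nlinarith [norm_nonneg μ]

/-- **Spectral theorem for unitary matrices.** Every `U ∈ M_N(ℂ)` with `Uᴴ U = 1` is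
`g · diag(e^{iθ_1}, …, e^{iθ_N}) · gᴴ` for some `g` with `gᴴ g = 1` and real angles `θ`
(the spectral theorem for normal matrices, Horn–Johnson, *Matrix Analysis* (2nd ed.), Thm. 2.5.3,
in the unitary case, where the eigenvalues are unimodular).
[cite: HornJohnson2013, Thm. 2.5.3 (spectral theorem for normal matrices; unitary case)] -/
theorem exists_unitary_diagonalization (U : Matrix (Fin N) (Fin N) ℂ) (hU : Uᴴ * U = 1) :
    ∃ (g : Matrix (Fin N) (Fin N) ℂ) (θ : Fin N → ℝ),
      gᴴ * g = 1 ∧ U = g * Matrix.diagonal (fun a => exp (θ a * I)) * gᴴ := by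
  set T := Matrix.toEuclideanLin U with hTdef
  have hT : LinearMap.IsIsometric T := isIsometric_toEuclideanLin U hU
  have hn : Module.finrank ℂ (EuclideanSpace ℂ (Fin N)) = N := finrank_euclideanSpace_fin
  set b := hT.eigenvectorBasis hn with hb
  set lam : Fin N → ℂ := hT.eigenvalues hn with hlam
  have hev : ∀ j, HasEigenvector T (lam j) (b j) := fun j => hT.hasEigenvector_eigenvectorBasis hn j
  -- the matrix of eigenvector columns
  set g : Matrix (Fin N) (Fin N) ℂ := fun i j => WithLp.ofLp (b j) i with hg
  -- (1) orthonormal columns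
  have hgg : gᴴ * g = 1 := by
    ext j k
    rw [Matrix.mul_apply, Matrix.one_apply]
    have hjk := (orthonormal_iff_ite.1 b.orthonormal) j k
    rw [EuclideanSpace.inner_eq_star_dotProduct, dotProduct] at hjk
    rw [← hjk]
    refine Finset.sum_congr rfl fun i _ => ?_
    rw [Matrix.conjTranspose_apply, Pi.star_apply, mul_comm]
  -- (2) eigenvector columns: U g = g diag(λ)
  have hUg : U * g = g * Matrix.diagonal lam := by
    ext i j
    have h1 : T (b j) = lam j • b j := mem_eigenspace_iff.1 (hev j).1
    have h2 : U *ᵥ WithLp.ofLp (b j) = lam j • WithLp.ofLp (b j) := by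
      have := congr_arg WithLp.ofLp h1
      rw [hTdef, Matrix.ofLp_toLpLin, Matrix.toLin'_apply, WithLp.ofLp_smul] at this
      exact this
    have h3 := congr_fun h2 i
    rw [Matrix.mul_diagonal, Matrix.mul_apply]
    simp only [Pi.smul_apply, smul_eq_mul] at h3
    rw [show (∑ k, U i k * g k j) = (U *ᵥ WithLp.ofLp (b j)) i from rfl, h3, hg, mul_comm]
  -- (3) unimodular eigenvalues
  have hθ : ∀ j, exp ((arg (lam j) : ℂ) * I) = lam j := fun j => by
    have h1 := hT.conj_mul_eigenvalue (hev j)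
    have h2 := norm_mul_exp_arg_mul_I (lam j)
    rw [norm_eq_one_of_conj_mul_self h1, Complex.ofReal_one, one_mul] at h2
    exact h2
  refine ⟨g, fun j => arg (lam j), hgg, ?_⟩
  have hD : Matrix.diagonal (fun a => exp ((arg (lam a) : ℂ) * I)) = Matrix.diagonal lam := by
    congr 1; funext a; exact hθ a
  rw [hD, ← hUg, Matrix.mul_assoc, mul_eq_one_comm.1 hgg, Matrix.mul_one]

end MatrixPart

end Literature.LinearAlgebra.Matrix
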